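import Summits.QuantumFields.YangMills.Theorems.MirrorModularBoostsHypercubicLimitPeelRpFamDefs
import Summits.QuantumFields.YangMills.Theorems.LangevinControlUVOSLegsFromFemtoAndGapStubAssemblyRPObservable
import HarnessLib

/-!
# Crux `HypercubicLimit` (stmt-QuantumFields-16154), line `peel-and-disseminate`: (R3b) vocabulary — the RP-adapted lattice functional

Route-vocabulary file (c3 seat, `--supports stmt-QuantumFields-16154`) for the registered piece (R3b)
`stub_decayOfSlabClustering` of the reflection leg (R) of the line (main file
`MirrorModularBoostsHypercubicLimitPeelDecayOfSlabClustering.lean`; lattice identities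
`MirrorModularBoostsHypercubicLimitPeelDecayLattice.lean`).  NOTHING here is asserted: the two `def`s name the
objects of the route and the theorems are definitional unfoldings.

* `rpPoint a q y` — the RP-adapted evaluation point of the plaquette of orientation `q = (i, j)` at the corner
  `y`: `a (y + (e_i + e_j − e₀)/2)` (VERBATIM the centre of the RP-adapted family `rpFam` of
  `MirrorModularBoostsHypercubicLimitPeelRpFamDefs.lean`; `rpPoint_eq`: `= a y + c_q` with the shift `rpShift`).
* `rpLat r L a m F` — **the RP-adapted lattice functional of an `n`-point test function `F` on
  `ℤ⁴`-configurations**: `V ↦ Σ_q Σ_{x ∈ Π D_{qₖ}} F(rpPoint a qₖ xₖ) ∏ₖ (plane_{qₖ}(xₖ)(V) − m_{qₖ})` (corner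
  ranges `rpDom L`, centring `m`).  Read through the periodic lift of the torus of side `N` it is the torus
  functional whose Wilson moments are the RP-adapted distributions (`rpLat_torusLift`, `rpFam_apply'`); it is
  the functional fed (real part, times `λⁿ`) to the RP-spectral slab clustering of `GapData` (iii).
* `abs_wilsonTorusMean_planeObs_le` (registered sub-goal): the centring constants `⟨p_q⟩_{β,2L+1}` of `rpFam`
  are bounded by `N_ρ` (unitarity), uniformly along a scheme.

Refs: OsterwalderSeiler1978 §§2–3 (lattice RP, transfer matrix); GlimmJaffe1987 §6.1;
`PencilRigidityHypercubicLimitDefs.lean` §2 (`GapData` (iii)), §7.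
-/

set_option autoImplicit false
noncomputable section
open scoped SchwartzMap
open MeasureTheory
open Literature.MathematicalPhysics.AQFT Literature.MathematicalPhysics.QuantumLattice
open Literature.MathematicalPhysics.QuantumFieldTheory
open Literature.Probability.LatticeModels (box Site)
open Summit.QuantumFields.YangMills.Cruxes.HypercubicLimit.ConditionalMeanTelescoping
open Summit.QuantumFields.YangMills.Cruxes.OSLegsFromFemtoAndGap.DlrCollarTransfer (plane)
open Summit.QuantumFields.YangMills.Theorems.HypercubicLimit.Negative (torusPlaquette)
open Summit.QuantumFields.YangMills.Theorems.OSLegsFromFemtoAndGap (plane_torusLift)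

namespace Summit.QuantumFields.YangMills.Cruxes.HypercubicLimit.PeelAndDisseminate

variable {G : Type} [Group G] [TopologicalSpace G] [MeasurableSpace G]

omit [TopologicalSpace G] [MeasurableSpace G] [Group G] in
/-- **The RP-adapted evaluation point** (plaquette centre) of the plaquette of orientation `q = (i, j)` at the
corner `y`, spacing `a`: `a (y + (e_i + e_j − e₀)/2)` — verbatim the centre of `rpFam`. -/
def rpPoint (a : ℝ) (q : {q : Fin 4 × Fin 4 // q.1 < q.2}) (y : Fin 4 → ℤ) : EuclideanSpace ℝ (Fin 4) :=
  a • (siteToE y + (2⁻¹ : ℝ) • (EuclideanSpace.single q.1.1 (1 : ℝ) + EuclideanSpace.single q.1.2 (1 : ℝ) -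
    EuclideanSpace.single 0 (1 : ℝ)))

/-- **The RP-adapted lattice functional** of an `n`-point test function `F` on `ℤ⁴`-configurations, at torus
half-side `L` (corner ranges `rpDom L`), spacing `a` and centring `m`:
`Σ_q Σ_{x ∈ Π D_{qₖ}} F(centres) ∏ₖ (plane_{qₖ}(xₖ) − m_{qₖ})`. -/
def rpLat (r : LatticeRep G) (L : ℕ) (a : ℝ) (m : {q : Fin 4 × Fin 4 // q.1 < q.2} → ℝ) {n : ℕ}
    (F : 𝓢((Fin n → EuclideanSpace ℝ (Fin 4)), ℂ)) (V : LGConfig 4 G) : ℂ :=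
  ∑ q : Fin n → {q : Fin 4 × Fin 4 // q.1 < q.2}, ∑ x ∈ Fintype.piFinset (fun k => rpDom L (q k)),
    F (fun k => rpPoint a (q k) (x k)) * ((∏ k, (plane G r (q k).1 (x k) V - m (q k)) : ℝ) : ℂ)

omit [TopologicalSpace G] [MeasurableSpace G] [Group G] in
/-- The RP-adapted centre is the scaled corner plus the short constant shift `c_q = rpShift a q`. -/
theorem rpPoint_eq (a : ℝ) (q : {q : Fin 4 × Fin 4 // q.1 < q.2}) (y : Fin 4 → ℤ) :
    rpPoint a q y = a • siteToE y + rpShift a q := by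
  simp only [rpPoint, rpShift, smul_add]

/-- The RP-adapted functional read through the periodic lift of the torus of side `N`, in terms of torus
plaquettes. -/
theorem rpLat_torusLift (r : LatticeRep G) (L N : ℕ) (a : ℝ) (m : {q : Fin 4 × Fin 4 // q.1 < q.2} → ℝ)
    {n : ℕ} (F : 𝓢((Fin n → EuclideanSpace ℝ (Fin 4)), ℂ)) (U : GaugeConfig 4 N G) :
    rpLat r L a m F (torusLift N U) = ∑ q : Fin n → {q : Fin 4 × Fin 4 // q.1 < q.2},
      ∑ x ∈ Fintype.piFinset (fun k => rpDom L (q k)),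
        F (fun k => rpPoint a (q k) (x k)) *
          ((∏ k, (torusPlaquette r N (q k).1.1 (q k).1.2 (x k) U - m (q k)) : ℝ) : ℂ) := by
  simp only [rpLat, plane_torusLift]

/-- Unfolding the RP-adapted family of a scheme at a test function: corner ranges `rpDom`, centres `rpPoint`,
weights `λⁿ ∫ ∏ₖ (p_{qₖ}(xₖ) − ⟨p_{qₖ}⟩)`. -/
theorem rpFam_apply' [IsTopologicalGroup G] [CompactSpace G] [BorelSpace G] (r : LatticeRep G) (β : ℝ) (L : ℕ)
    (a lam : ℝ) (n : ℕ) (F : 𝓢((Fin n → EuclideanSpace ℝ (Fin 4)), ℂ)) :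
    rpFam r β L a lam n F = ∑ q : Fin n → {q : Fin 4 × Fin 4 // q.1 < q.2},
      ∑ x ∈ Fintype.piFinset (fun k => rpDom L (q k)),
        (((lam ^ n * ∫ U, ∏ k, (torusPlaquette r (2 * L + 1) (q k).1.1 (q k).1.2 (x k) U -
            wilsonTorusMean r.ρ β L (planeObs r (q k).1))
          ∂(wilsonMeasure r.ρ β : Measure (GaugeConfig 4 (2 * L + 1) G)) : ℝ) : ℂ)) *
          F (fun k => rpPoint a (q k) (x k)) := by
  simp only [rpFam, _root_.sum_apply, _root_.smul_apply, LabelledSchwingerFamily.evalAt_apply, smul_eq_mul]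
  rfl

/-- **The torus mean of a plane field is bounded by the dimension of the representation** (unitarity of
`r.ρ`; the centring constants of `rpFam` are bounded uniformly along a scheme).  Registered sub-goal of the
(R3b) vocabulary file. -/
theorem abs_wilsonTorusMean_planeObs_le :
    ∀ {G : Type} [Group G] [TopologicalSpace G] [IsTopologicalGroup G] [CompactSpace G] [MeasurableSpace G]
      [BorelSpace G] (r : LatticeRep G) (β : ℝ) (L : ℕ) (p : Fin 4 × Fin 4),
      |wilsonTorusMean r.ρ β L (planeObs r p)| ≤ r.N := by
  intro G _ _ _ _ _ _ r β L p
  haveI := isProbabilityMeasure_wilsonMeasure (d := 4) (L := 2 * L + 1) r.ρ r.continuous β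
  rw [← integral_torusPlaquette r β L p 0]
  have h := norm_integral_le_of_norm_le_const
    (μ := (wilsonMeasure r.ρ β : Measure (GaugeConfig 4 (2 * L + 1) G)))
    (f := fun V => torusPlaquette r (2 * L + 1) p.1 p.2 0 V) (C := (r.N : ℝ))
    (Filter.Eventually.of_forall fun V => by
      rw [Real.norm_eq_abs]
      exact abs_plaquetteObs_le_holds (ρ := r.ρ) r.mem_unitary 0 p.1 p.2 _)
  simpa [Real.norm_eq_abs] using h

end Summit.QuantumFields.YangMills.Cruxes.HypercubicLimit.PeelAndDisseminate

end
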